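/-
Copyright (c) 2026. All rights reserved.
Released under Apache 2.0 license as described in the file LICENSE.
-/
import Literature.AlgebraicGeometry.Pohlmann1968.MultiquadraticCMFieldRankFiveTypesHodgeConjecture
import Literature.AlgebraicGeometry.Pohlmann1968.DegenerateCMTypesCyclicCMFieldPrimeSquare
import Literature.NumberTheory.ComplexMultiplication.DegenerateCMTypesElementaryAbelianRankFiveCensus
import HarnessLib

/-!
# A multiquadratic CM field of degree `2^{n+1}` has exactly `2·C(2ⁿ, 3)` CM types of Kubota rank `5`

SETTING.  `K` a MULTIQUADRATIC CM field — Galois over `ℚ` with `Gal(K/ℚ)` of exponent `2` (then abelian, tree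
`Multiquadratic.isAbelianGalois_of_forall_sq_eq_one`) — of degree `[K:ℚ] = 2^{n+1}`, `Φ` a CM type,
`Rank(Φ) = cmTypeRank Φ` the Kubota–Dodson rank (T. Kubota [Kubota1965] §4 Lemma 2 = B. B. Gordon
[Gordon1999HodgeAVSurvey] Prop. 9.4.1).  The
tree knows the rank-`5` types of `K` structurally (`MultiquadraticCMFieldRankFiveTypesHodgeConjecture`: they are
induced from the nondegenerate types of the octic CM subfields, carry no exceptional Hodge classes on any power,
`exists_inducedCMType_octic_isNondegenerate_of_cmTypeRank_eq_five`, `hodgeConjectureFor_pow_of_cmTypeRank_eq_five`)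
and counts them on the Galois group (`DegenerateCMTypesElementaryAbelianRankFiveCensus`:
`ExponentTwo.card_filter_typeRank_eq_five`, `2·C(|G|/2, 3)`).  THIS FILE is the one-step number-field dress:

> **Theorem** (`ncard_cmTypeRank_eq_five`).  A multiquadratic CM field of degree `2^{n+1}` has exactly
> **`2·C(2ⁿ, 3)` CM types of rank `5`** — `8` of its `16` types in degree `8` (the nondegenerate ones), `112` of
> `256` in degree `16`, `1120` of `65536` in degree `32` (`ncard_cmTypeRank_eq_five_of_finrank_eq_eight / sixteen /
> thirtyTwo`).

Dictionary (not restated): CM types of `K` ↔ group-level CM types of `Gal(K/ℚ)` for `ρ = conjGal` with the same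
rank (`CyclicPrimeSquare.ncard_cmType_sep_eq`, `CyclicTwoOddPrimes.cmTypeRank_eq_typeRank_galType`,
`AbelianCMFieldExistence.apply_conjGal_eq`, `conjGalElt_ne_one`, `card_gal_eq_finrank`).

HONEST SCOPE.  The number is the tree's group-level count transported; the sources print Kubota's formula and the
induced-type dictionary, not this number.  THEOREMS ONLY: no definition, no named fact, no instance, no `sorry`.

## References

* [Kubota1965] T. Kubota, *On the field extension by complex multiplication*, Trans. AMS 118 (1965), §2, §4 Lemma 2.
* [Gordon1999HodgeAVSurvey] B. B. Gordon, *A survey of the Hodge conjecture for abelian varieties*, §9.4.1, §9.4.2.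
* [Dodson1984] B. Dodson, *The structure of Galois groups of CM-fields*, Trans. AMS 283 (1984), §3.1.1.
* [Shimura1998] G. Shimura, *Abelian Varieties with Complex Multiplication and Modular Functions*, §8.1, §8.4
  Example (1), §18.2 Lemma (i).

## Provenance

Lane `lit-hodgefound` (Track 2, Layer A3/A4), seat `lit-hodgefound-p10` generation 40, row g40-#11 (field dress of
row g40-#10).
-/

open scoped BigOperators NumberField IsMulCommutative Classical
open NumberField Module

namespace Literature.AlgebraicGeometry.Pohlmann1968

open scoped Literature.NumberTheory.ComplexMultiplication
open Literature.NumberTheory.ComplexMultiplication (typeRank IsCMTypeWith conjGal)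
open Literature.NumberTheory.ComplexMultiplication.CyclicCMType.ExponentTwo
  (card_filter_typeRank_eq_five_of_card_eq_two_pow)
open Literature.AlgebraicGeometry.Pohlmann1968.CyclicTwoOddPrimes (cmTypeRank_eq_typeRank_galType)
open Literature.AlgebraicGeometry.Motives (CMType)

variable {K : Type} [Field K] [NumberField K] [IsCMField K] [IsGalois ℚ K]

/-- **A MULTIQUADRATIC CM FIELD OF DEGREE `2^{n+1}` HAS EXACTLY `2·C(2ⁿ, 3)` CM TYPES OF RANK `5`.**
[cite: Kubota1965, §2 and §4 Lemma 2] [cite: Gordon1999HodgeAVSurvey, Prop. 9.4.1] [cite: Dodson1984, §3.1.1]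
[cite: Shimura1998, §8.4 Example (1)] -/
theorem ncard_cmTypeRank_eq_five (hexp : ∀ g : K ≃ₐ[ℚ] K, g ^ 2 = 1) (φ₀ : K →+* ℂ) {n : ℕ}
    (hK : finrank ℚ K = 2 ^ (n + 1)) :
    {Φ : CMType K | cmTypeRank Φ = 5}.ncard = 2 * Nat.choose (2 ^ n) 3 := by
  haveI := Multiquadratic.isAbelianGalois_of_forall_sq_eq_one hexp
  have hρ := AbelianCMFieldExistence.apply_conjGal_eq (K := K) φ₀
  rw [CyclicPrimeSquare.ncard_cmType_sep_eq hρ (fun Φ : CMType K => cmTypeRank Φ = 5)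
    (fun T : Finset (K ≃ₐ[ℚ] K) => typeRank (K ≃ₐ[ℚ] K) (T : Set (K ≃ₐ[ℚ] K)) = 5)
    (fun Φ => by rw [cmTypeRank_eq_typeRank_galType Φ φ₀])]
  have hset : {ΦG : Finset (K ≃ₐ[ℚ] K) | IsCMTypeWith (conjGal : K ≃ₐ[ℚ] K) (ΦG : Set (K ≃ₐ[ℚ] K)) ∧
      typeRank (K ≃ₐ[ℚ] K) (ΦG : Set (K ≃ₐ[ℚ] K)) = 5} =
      ↑((Finset.univ : Finset (Finset (K ≃ₐ[ℚ] K))).filter fun T : Finset (K ≃ₐ[ℚ] K) =>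
        IsCMTypeWith (conjGal : K ≃ₐ[ℚ] K) (T : Set (K ≃ₐ[ℚ] K)) ∧
          typeRank (K ≃ₐ[ℚ] K) (T : Set (K ≃ₐ[ℚ] K)) = 5) := by
    ext T; simp
  rw [hset, Set.ncard_coe_finset]
  have hcard : Fintype.card (K ≃ₐ[ℚ] K) = 2 ^ (n + 1) := by rw [card_gal_eq_finrank φ₀, hK]
  exact card_filter_typeRank_eq_five_of_card_eq_two_pow hexp (conjGalElt_ne_one hρ) hcard

/-- **Degree `8`: exactly `8` CM types of rank `5`** (of `16`; the nondegenerate ones). [cite: Kubota1965, §4 Lemma 2]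
[cite: Shimura1998, §8.4 Example (1)] -/
theorem ncard_cmTypeRank_eq_five_of_finrank_eq_eight (hexp : ∀ g : K ≃ₐ[ℚ] K, g ^ 2 = 1) (φ₀ : K →+* ℂ)
    (hK : finrank ℚ K = 8) : {Φ : CMType K | cmTypeRank Φ = 5}.ncard = 8 := by
  rw [ncard_cmTypeRank_eq_five hexp φ₀ (n := 2) (by rw [hK]; norm_num)]; decide

/-- **Degree `16`: exactly `112` CM types of rank `5`** (of `256`). [cite: Kubota1965, §4 Lemma 2]
[cite: Dodson1984, §3.1.1] -/
theorem ncard_cmTypeRank_eq_five_of_finrank_eq_sixteen (hexp : ∀ g : K ≃ₐ[ℚ] K, g ^ 2 = 1) (φ₀ : K →+* ℂ)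
    (hK : finrank ℚ K = 16) : {Φ : CMType K | cmTypeRank Φ = 5}.ncard = 112 := by
  rw [ncard_cmTypeRank_eq_five hexp φ₀ (n := 3) (by rw [hK]; norm_num)]; decide

/-- **Degree `32`: exactly `1120` CM types of rank `5`** (of `65536`). [cite: Kubota1965, §4 Lemma 2]
[cite: Dodson1984, §3.1.1] -/
theorem ncard_cmTypeRank_eq_five_of_finrank_eq_thirtyTwo (hexp : ∀ g : K ≃ₐ[ℚ] K, g ^ 2 = 1) (φ₀ : K →+* ℂ)
    (hK : finrank ℚ K = 32) : {Φ : CMType K | cmTypeRank Φ = 5}.ncard = 1120 := by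
  rw [ncard_cmTypeRank_eq_five hexp φ₀ (n := 4) (by rw [hK]; norm_num)]; decide

end Literature.AlgebraicGeometry.Pohlmann1968
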